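import Literature.AlgebraicGeometry.AbelianSchemes.PolarizationSpreadTransport
import Literature.AlgebraicGeometry.AbelianSchemes.AbelianSchemeLDeltaOfLambdaGlobal
import Literature.AlgebraicGeometry.AbelianSchemes.AbelianSchemeMumfordBundleClassifierAnyBase
import Literature.AlgebraicGeometry.AbelianSchemes.AbelianSchemeOverHomEqOfGeometricFibres
import Literature.AlgebraicGeometry.AbelianSchemes.AbelianSchemeQuotientMulNDescent
import Literature.AlgebraicGeometry.AbelianSchemes.PolarizationOfLDeltaCubeLocus
import HarnessLib

/-!
# `Λ(L^Δ(λₛ)) = λₛ·λₛ` AT A STAGE, and `λ̄ₛ² = Λ(𝒪(Θ))` at EVERY point of the stage for the divisor `Θ` of `L^Δ(λₛ)|_{A_z}`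
# ([MumfordFogartyKirwan1994] Prop. 6.10, read for a homomorphism which is a polarization only GENERICALLY) — the `hsq` discharge of (s2-λ)

Layer `Literature/AlgebraicGeometry/AbelianSchemes`, namespace `Literature.AlgebraicGeometry.AbelianSchemes.AbelianSchemeOver`.  THEOREMS ONLY
(no definition, no named fact, no instance, no notation, no `sorry`).  Cell `hodgecm-mathlib` (D-0151), FLOOR 0, P6 «MOD programme» (crux
hLiu418 = stmt-HodgeConjecture-24832), SPREAD door, item (s2-λ) / road «Θ-SPREAD» (LEAD F0P6-plan (g2) RULINGS M-28 (3), M-28′; B-p18 (g38)):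
organ O3′ «`hsq` DISCHARGE» — the first of the two by-value binders of ★ `PolarizationSpreadStageAmpleLocus.exists_stage_polarization_of_sq_root`
(p847084).  HC_CM is proved only modulo the printed citations until rung 0 closes; this file is generic and changes no count.

THE POINT.  [MumfordFogartyKirwan1994] Prop. 6.10: `Λ(L^Δ(λ)) = 2λ` for a POLARIZATION `λ`; the tree has it globally over a connected locally
Noetherian base for a ★ `Polarization` (★ `eq_mul_self_of_classify_mumfordBundle_LDelta`) and POINTWISE at a geometric point carrying a witness
`λ̄ = Λ(𝒪(Θ))` (★ `pullback_map_eq_pullback_map_mul_self`).  At a stage `P ⊗ D(s)` the spread homomorphism `λₛ` (★ `exists_stage_monHom`) is a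
polarization only at the geometric points coming from the GENERIC base (★ `PolarizationSpreadTransport`); at the characteristic-`p` points there is
no witness.  Flatness of the stage replaces connectedness∕witnesses: the two homomorphisms `Λ(L^Δ(λₛ))`, `λₛ·λₛ` agree after base change to the
generic base — there, at EVERY geometric point, by the pointwise Prop. 6.10 — hence agree at the stage (★ `stage_hom_eq_of_generic_eq`, the relative
leg being schematically dominant).  Then ★ `isLambdaOfAt_of_classify_mumfordBundle_of_iso` reads `λ̄ₛ² = Λ(𝒪(Θ₂))` at EVERY field-valued point `z`
of the stage, for every `Θ₂` with `L^Δ(λₛ)|_{A_z} ≅ 𝒪(Θ₂)` — characteristic-free, square-root-free.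

* (inside §3, not exported: `L^Δ(λₛ) = Gr^*𝒫ₛ` is rigidified along `ε_A` for the HOMOMORPHISM `λₛ` — the proof of ★
  `Polarization.cechPic_pullback_unitSection_detClass_LDelta_eq_one`, which is typed for a ★ `Polarization` and uses only `ε_A ≫ λ = ε_Â`.)
* §1 (any locally Noetherian `S′`, any `ℓ : S′ → S`) **`pullback_map_eq_of_forall_geometricPoint_comp`** — two homomorphisms `f, g : A → B` of
  abelian schemes over `S` whose base changes to every geometric point of `S′` (through `ℓ`) agree have equal base changes along `ℓ`
  (★ `hom_eq_of_forall_pullback_map_eq_of_isLocallyNoetherian_base` over `S′` + Mathlib `Over.pullbackComp` naturality).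
* §2 (the localisation tower over a domain `A`, `K = Frac A`, stage `s` flat and locally Noetherian, generic base locally Noetherian)
  **`classify_LDelta_eq_mul_self_of_generic_polarization`** — `Λ(L^Δ(λₛ)) = λₛ·λₛ` for the spread `λₛ` of a generic polarization `pol`
  (`facObjIso` clause `hz`); **`exists_classify_LDelta_eq_mul_self`** — existence (★ `exists_isMonHom_classify_mumfordBundle_of_isLocallyNoetherian_base`,
  unit hypothesis `hD` for the stage dual pair BY VALUE); **`isLambdaOfAt_sq_of_iso_LDelta`** — THE `hsq` BINDER of ★ p847084 verbatim:
  `IsLambdaOfAt z (Dₜ|ₛ) (λₛ ^ 2) Θ₂` for every field-valued `z` and every `Θ₂` with `L^Δ(λₛ)|_{A_z} ≅ 𝒪(Θ₂)`.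

## References
* [MumfordFogartyKirwan1994] D. Mumford, J. Fogarty, F. Kirwan, *Geometric Invariant Theory*, 3rd ed. (1994), Ch. 6 §1 Cor. 6.2 and 6.4 (p. 117),
  §2 Def. 6.2–6.3 (p. 120), Prop. 6.10 (p. 121).
* [MumfordAV1970] D. Mumford, *Abelian Varieties* (1970), §8 (pp. 74–75), §13 (pp. 123–125).
* [EGAIV3] A. Grothendieck, J. Dieudonné, *EGA IV₃* (1966), 11.10.5.
* [GortzWedhorn2020] U. Görtz, T. Wedhorn, *Algebraic Geometry I*, 2nd ed. (2020), §(4.7) Prop. 4.16, Prop. 9.19 and Rem. 9.20.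
-/

set_option autoImplicit false

noncomputable section

universe u

open CategoryTheory CategoryTheory.Limits AlgebraicGeometry MonoidalCategory CartesianMonoidalCategory
open scoped MonObj CategoryTheory.Obj

namespace Literature.AlgebraicGeometry.AbelianSchemes

namespace AbelianSchemeOver

open Literature.AlgebraicGeometry.Motives Literature.AlgebraicGeometry.AbelianVarieties Literature.AlgebraicGeometry.Modules
open Literature.AlgebraicGeometry.Limits Literature.AlgebraicGeometry.Limits.LocApprox Literature.AlgebraicGeometry.Limits.OverFac

/-! ## §1 Base changes along `ℓ : S′ → S` agreeing at every geometric point of `S′` are equal -/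

section Pointwise

variable {S S' : Scheme.{u}} [IsLocallyNoetherian S'] (ℓ : S' ⟶ S) (A B : AbelianSchemeOver S) (f g : A.X ⟶ B.X)
  [IsMonHom f] [IsMonHom g]

/-- **Two homomorphisms `f, g : A → B` of abelian schemes over `S` whose base changes to EVERY geometric point `ȳ ≫ ℓ` (`ȳ` a geometric point
of a locally Noetherian `S′`, `ℓ : S′ → S`) coincide have EQUAL base changes along `ℓ`**: ★ `hom_eq_of_forall_pullback_map_eq_of_isLocallyNoetherian_base`
over `S′` for `f ×_S S′`, `g ×_S S′`, whose base changes to `ȳ` are those of `f`, `g` to `ȳ ≫ ℓ` conjugated by Mathlib's `Over.pullbackComp ȳ ℓ`.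
[cite: MumfordFogartyKirwan1994, Ch. 6 §1 Corollary 6.2 and Corollary 6.4 (p. 117)] [cite: GortzWedhorn2020, §(4.7) Prop. 4.16] -/
theorem pullback_map_eq_of_forall_geometricPoint_comp
    (h : ∀ (Ω : Type u) [Field Ω] [IsAlgClosed Ω] (yb : Spec (.of Ω) ⟶ S'),
      (Over.pullback (yb ≫ ℓ)).map f = (Over.pullback (yb ≫ ℓ)).map g) :
    (Over.pullback ℓ).map f = (Over.pullback ℓ).map g := by
  -- (`IsMonHom` of the base-changed maps is passed by term: `(A.baseChange ℓ).X` is `(Over.pullback ℓ).obj A.X` only up to unfolding)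
  refine @hom_eq_of_forall_pullback_map_eq_of_isLocallyNoetherian_base S' _ (A.baseChange ℓ) (B.baseChange ℓ)
    ((Over.pullback ℓ).map f) ((Over.pullback ℓ).map g) (Functor.map.instIsMonHom _ _ f) (Functor.map.instIsMonHom _ _ g)
    fun Ω _ _ yb => ?_
  have nf := (Over.pullbackComp yb ℓ).hom.naturality f
  have ng := (Over.pullbackComp yb ℓ).hom.naturality g
  -- `e ≫ ((f ×_S S′) ×_{S′} ȳ) = (f ×_S (ȳ ≫ ℓ)) ≫ e` for the transitivity isomorphism `e`
  have key : (Over.pullbackComp yb ℓ).hom.app A.X ≫ (Over.pullback ℓ ⋙ Over.pullback yb).map f =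
      (Over.pullbackComp yb ℓ).hom.app A.X ≫ (Over.pullback ℓ ⋙ Over.pullback yb).map g := by
    rw [← nf, ← ng, h Ω yb]
  have key₂ : (Over.pullbackComp yb ℓ).inv.app A.X ≫ (Over.pullbackComp yb ℓ).hom.app A.X ≫ (Over.pullback ℓ ⋙ Over.pullback yb).map f =
      (Over.pullbackComp yb ℓ).inv.app A.X ≫ (Over.pullbackComp yb ℓ).hom.app A.X ≫ (Over.pullback ℓ ⋙ Over.pullback yb).map g := by
    rw [key]
  rw [Iso.inv_hom_id_app_assoc, Iso.inv_hom_id_app_assoc] at key₂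
  exact key₂

end Pointwise

/-! ## §2 At a stage: `Λ(L^Δ(λₛ)) = λₛ·λₛ`, and `λ̄ₛ² = Λ(𝒪(Θ))` at every point -/

section Stage

variable {A : Type u} [CommRing A] [IsDomain A] (K : Type u) [Field K] [Algebra A K] [IsFractionRing A K]
  {P : SchemeOver A} {s t : Idx (nonZeroDivisors A)} (σ : s ⟶ t)
  [IsLocallyNoetherian (P ⊗ (baseDiagram (nonZeroDivisors A)).obj s).left]
  [IsLocallyNoetherian (P ⊗ specOver A K).left]
  [Flat (pullback.snd P.hom ((baseDiagram (nonZeroDivisors A)).obj s).hom)]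
  (𝒜ₜ : AbelianSchemeOver (P ⊗ (baseDiagram (nonZeroDivisors A)).obj t).left) (Dₜ : 𝒜ₜ.DualPair)
  (pol : (𝒜ₜ.baseChange (genOver (nonZeroDivisors A) K P t).hom).Polarization (Dₜ.baseChange (genOver (nonZeroDivisors A) K P t).hom))
  (lamₛ : (𝒜ₜ.baseChange (stageOver (nonZeroDivisors A) P σ).hom).X ⟶ (Dₜ.baseChange (stageOver (nonZeroDivisors A) P σ).hom).hat.X)
  [IsMonHom lamₛ]
  (hz : (Over.pullback (relLeg (nonZeroDivisors A) K P σ).left).map lamₛ ≫ (facObjIso (relLeg (nonZeroDivisors A) K P σ) Dₜ.hat.X).hom =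
    (facObjIso (relLeg (nonZeroDivisors A) K P σ) 𝒜ₜ.X).hom ≫ pol.lam)
  (Gr : (𝒜ₜ.baseChange (stageOver (nonZeroDivisors A) P σ).hom).X.left ⟶
    (𝒜ₜ.baseChange (stageOver (nonZeroDivisors A) P σ).hom).prodLeft (Dₜ.baseChange (stageOver (nonZeroDivisors A) P σ).hom).hat)
  (hGr₁ : Gr ≫ pullback.fst _ _ = 𝟙 _) (hGr₂ : Gr ≫ pullback.snd _ _ = lamₛ.left)

include hz hGr₁ hGr₂ in
/-- **`Λ(L^Δ(λₛ)) = λₛ·λₛ` AT A FLAT STAGE** ([MumfordFogartyKirwan1994] Prop. 6.10 for a homomorphism which is a polarization only generically):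
`A` a domain, `K = Frac A`, the stage `P ⊗ D(s) → D(s)` flat, `P ⊗ D(s)` and `P ⊗ Spec K` locally Noetherian; `𝒜ₜ` over `P ⊗ D(t)` with dual
pair `Dₜ`, `pol` a polarization of `(𝒜ₜ)_K` for the base-changed dual pair, `σ : s ⟶ t`, `λₛ : 𝒜ₜ|ₛ → Âₜ|ₛ` a homomorphism restricting to
`pol.lam` along the relative leg (★ `facObjIso` clause `hz`), `Gr = (1, λₛ)` its graph; then EVERY homomorphism `lamL : 𝒜ₜ|ₛ → Âₜ|ₛ` classifying
the Mumford family of `L^Δ(λₛ) = Gr^*𝒫ₛ` equals `λₛ·λₛ`.  Proof: at each geometric point `ȳ` of the generic base, `λ̄ₛ = Λ(𝒪(Θ))` at `ȳ ≫ ℓ`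
(★ `forall_exists_isAmple_isLambdaOfAt_leg_of_polarization`), so `lamL` and `λₛ·λₛ` agree after base change to `ȳ ≫ ℓ` (★
`pullback_map_eq_pullback_map_mul_self`); hence their base changes along the relative leg `ℓ` agree (§1 over `P ⊗ Spec K`), hence they agree
(★ `stage_hom_eq_of_generic_eq`: `𝒜ₜ|ₛ` flat, `Âₜ|ₛ` separated, `ℓ` schematically dominant).
[cite: MumfordFogartyKirwan1994, Ch. 6 §2 Proposition 6.10 (p. 121)] [cite: EGAIV3, 11.10.5] -/
theorem classify_LDelta_eq_mul_self_of_generic_polarization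
    (lamL : (𝒜ₜ.baseChange (stageOver (nonZeroDivisors A) P σ).hom).X ⟶ (Dₜ.baseChange (stageOver (nonZeroDivisors A) P σ).hom).hat.X)
    [IsMonHom lamL]
    (hlamL : ∀ ⦃T : Over (stageOver (nonZeroDivisors A) P σ).left⦄ (u : T ⟶ (𝒜ₜ.baseChange (stageOver (nonZeroDivisors A) P σ).hom).X),
      Nonempty ((Scheme.Modules.pullback ((𝒜ₜ.baseChange (stageOver (nonZeroDivisors A) P σ).hom).X ◁ (u ≫ lamL)).left).obj
          (Dₜ.baseChange (stageOver (nonZeroDivisors A) P σ).hom).P ≅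
        (Scheme.Modules.pullback ((𝒜ₜ.baseChange (stageOver (nonZeroDivisors A) P σ).hom).X ◁ u).left).obj
          ((𝒜ₜ.baseChange (stageOver (nonZeroDivisors A) P σ).hom).mumfordBundle
            ((Scheme.Modules.pullback Gr).obj (Dₜ.baseChange (stageOver (nonZeroDivisors A) P σ).hom).P)))) :
    lamL = lamₛ * lamₛ := by
  -- abbreviations
  let 𝒜₁ := 𝒜ₜ.baseChange (stageOver (nonZeroDivisors A) P σ).hom
  let D₁ : 𝒜₁.DualPair := Dₜ.baseChange (stageOver (nonZeroDivisors A) P σ).hom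
  haveI : IsLocallyNoetherian (stageOver (nonZeroDivisors A) P σ).left :=
    inferInstanceAs (IsLocallyNoetherian (P ⊗ (baseDiagram (nonZeroDivisors A)).obj s).left)
  haveI : IsLocallyNoetherian (genOver (nonZeroDivisors A) K P t).left :=
    inferInstanceAs (IsLocallyNoetherian (P ⊗ specOver A K).left)
  haveI : IsCommMonObj D₁.hat.X := D₁.hat.isCommMonObj_of_isLocallyNoetherian_base
  haveI : IsMonHom (lamₛ * lamₛ) := D₁.hat.isMonHom_mul lamₛ lamₛ
  -- the rigidification `ε^*[L^Δ(λₛ)] = 1` (proof of ★ `Polarization.cechPic_pullback_unitSection_detClass_LDelta_eq_one`, for a homomorphism)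
  have hgr : 𝒜₁.unitSection ≫ Gr = D₁.hat.unitSection ≫ 𝒜₁.unitSlice D₁.hat := by
    apply pullback.hom_ext
    · rw [Category.assoc, hGr₁, Category.comp_id, Category.assoc, AbelianSchemeOver.unitSlice_fst, ← Category.assoc,
        D₁.hat.unitSection_comp_hom, Category.id_comp]
    · rw [Category.assoc, hGr₂, Category.assoc, AbelianSchemeOver.unitSlice_snd, Category.comp_id]
      change (η[𝒜₁.X]).left ≫ lamₛ.left = (η[D₁.hat.X]).left
      rw [← Over.comp_left, IsMonHom.one_hom]
  have hε : CechPic.pullback 𝒜₁.unitSection (detClass (HasRank.isFiniteLocallyFree' (hasRank_pullback Gr D₁.hasRank_one))) = 1 := by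
    obtain ⟨r⟩ := D₁.rigid
    rw [(detClass_eq_of_iso (Iso.refl _) _ ((HasRank.isFiniteLocallyFree' D₁.hasRank_one).pullback Gr)).trans
        (detClass_pullback Gr (HasRank.isFiniteLocallyFree' D₁.hasRank_one)),
      ← CechPic.pullback_comp, hgr, CechPic.pullback_comp,
      ← detClass_pullback (𝒜₁.unitSlice D₁.hat) (HasRank.isFiniteLocallyFree' D₁.hasRank_one),
      detClass_eq_of_iso r ((HasRank.isFiniteLocallyFree' D₁.hasRank_one).pullback _)
        (HasRank.isFiniteLocallyFree' hasRank_unitModule),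
      detClass_unitModule_eq_one, map_one]
  -- `hlamL` in the `pullbackP` spelling of ★ `pullback_map_eq_pullback_map_mul_self`
  have hlamL' : ∀ ⦃T : Over (stageOver (nonZeroDivisors A) P σ).left⦄ (u : T ⟶ 𝒜₁.X),
      Nonempty (D₁.pullbackP T.hom (u ≫ lamL).left (Over.w _) ≅
        (Scheme.Modules.pullback (𝒜₁.X ◁ u).left).obj (𝒜₁.mumfordBundle ((Scheme.Modules.pullback Gr).obj D₁.P))) :=
    fun T u => by rw [D₁.pullbackP_eq_pullback_whiskerLeft]; exact hlamL u
  -- (3) equality at the stage from equality along the relative leg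
  haveI : Flat 𝒜₁.X.hom := by haveI := 𝒜₁.isSmooth; infer_instance
  haveI : IsSeparated D₁.hat.X.hom := by haveI := D₁.hat.isProper; infer_instance
  apply stage_hom_eq_of_generic_eq K σ
  -- (2) equality along the leg from equality at every geometric point of the generic base
  refine pullback_map_eq_of_forall_geometricPoint_comp (relLeg (nonZeroDivisors A) K P σ).left 𝒜₁ D₁.hat lamL (lamₛ * lamₛ)
    fun Ω _ _ yb => ?_
  -- (1) the pointwise Prop. 6.10 at `ȳ ≫ ℓ`, with the transported witness
  obtain ⟨Θ, -, hΛ⟩ := forall_exists_isAmple_isLambdaOfAt_leg_of_polarization K σ 𝒜ₜ Dₜ pol lamₛ hz Ω yb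
  exact 𝒜₁.pullback_map_eq_pullback_map_mul_self D₁ (yb ≫ (relLeg (nonZeroDivisors A) K P σ).left) lamₛ Gr hGr₁ hGr₂ hε lamL hlamL'
    ⟨Θ, hΛ⟩

include hz hGr₁ hGr₂ in
/-- **`λₛ·λₛ` CLASSIFIES THE MUMFORD FAMILY OF `L^Δ(λₛ)`** (existence form: ★ `exists_isMonHom_classify_mumfordBundle_of_isLocallyNoetherian_base` on the
locally Noetherian stage, given the unit hypothesis `hD` «`𝒫ₛ|_{A × {ε_Â}} ≅ 𝒪`» of the stage dual pair — e.g. after ★ `AbelianSchemeDualPairNormalize` — and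
the previous theorem). [cite: MumfordFogartyKirwan1994, Ch. 6 §2 Proposition 6.10 (p. 121) and Definition 6.2 (p. 120)] [cite: MumfordAV1970, §13 (pp. 123–125)] -/
theorem classify_mumfordBundle_LDelta_mul_self
    (hD : Nonempty ((Scheme.Modules.pullback (DualPair.unitHatSlice (Dₜ.baseChange (stageOver (nonZeroDivisors A) P σ).hom))).obj
      (Dₜ.baseChange (stageOver (nonZeroDivisors A) P σ).hom).P ≅ SheafOfModules.unit _)) :
    ∀ ⦃T : Over (stageOver (nonZeroDivisors A) P σ).left⦄ (u : T ⟶ (𝒜ₜ.baseChange (stageOver (nonZeroDivisors A) P σ).hom).X),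
      Nonempty ((Scheme.Modules.pullback ((𝒜ₜ.baseChange (stageOver (nonZeroDivisors A) P σ).hom).X ◁ (u ≫ (lamₛ * lamₛ))).left).obj
          (Dₜ.baseChange (stageOver (nonZeroDivisors A) P σ).hom).P ≅
        (Scheme.Modules.pullback ((𝒜ₜ.baseChange (stageOver (nonZeroDivisors A) P σ).hom).X ◁ u).left).obj
          ((𝒜ₜ.baseChange (stageOver (nonZeroDivisors A) P σ).hom).mumfordBundle
            ((Scheme.Modules.pullback Gr).obj (Dₜ.baseChange (stageOver (nonZeroDivisors A) P σ).hom).P))) := by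
  let 𝒜₁ := 𝒜ₜ.baseChange (stageOver (nonZeroDivisors A) P σ).hom
  let D₁ : 𝒜₁.DualPair := Dₜ.baseChange (stageOver (nonZeroDivisors A) P σ).hom
  haveI : IsLocallyNoetherian (stageOver (nonZeroDivisors A) P σ).left :=
    inferInstanceAs (IsLocallyNoetherian (P ⊗ (baseDiagram (nonZeroDivisors A)).obj s).left)
  -- the rigidification `ε^*[L^Δ(λₛ)] = 1` (proof of ★ `Polarization.cechPic_pullback_unitSection_detClass_LDelta_eq_one`, for a homomorphism)
  have hgr : 𝒜₁.unitSection ≫ Gr = D₁.hat.unitSection ≫ 𝒜₁.unitSlice D₁.hat := by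
    apply pullback.hom_ext
    · rw [Category.assoc, hGr₁, Category.comp_id, Category.assoc, AbelianSchemeOver.unitSlice_fst, ← Category.assoc,
        D₁.hat.unitSection_comp_hom, Category.id_comp]
    · rw [Category.assoc, hGr₂, Category.assoc, AbelianSchemeOver.unitSlice_snd, Category.comp_id]
      change (η[𝒜₁.X]).left ≫ lamₛ.left = (η[D₁.hat.X]).left
      rw [← Over.comp_left, IsMonHom.one_hom]
  have hε : CechPic.pullback 𝒜₁.unitSection (detClass (HasRank.isFiniteLocallyFree' (hasRank_pullback Gr D₁.hasRank_one))) = 1 := by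
    obtain ⟨r⟩ := D₁.rigid
    rw [(detClass_eq_of_iso (Iso.refl _) _ ((HasRank.isFiniteLocallyFree' D₁.hasRank_one).pullback Gr)).trans
        (detClass_pullback Gr (HasRank.isFiniteLocallyFree' D₁.hasRank_one)),
      ← CechPic.pullback_comp, hgr, CechPic.pullback_comp,
      ← detClass_pullback (𝒜₁.unitSlice D₁.hat) (HasRank.isFiniteLocallyFree' D₁.hasRank_one),
      detClass_eq_of_iso r ((HasRank.isFiniteLocallyFree' D₁.hasRank_one).pullback _)
        (HasRank.isFiniteLocallyFree' hasRank_unitModule),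
      detClass_unitModule_eq_one, map_one]
  obtain ⟨lamL, hmon, hlamL, -⟩ := 𝒜₁.exists_isMonHom_classify_mumfordBundle_of_isLocallyNoetherian_base D₁
    (hasRank_pullback Gr D₁.hasRank_one) hε hD
  haveI := hmon
  have e := classify_LDelta_eq_mul_self_of_generic_polarization K σ 𝒜ₜ Dₜ pol lamₛ hz Gr hGr₁ hGr₂ lamL hlamL
  rw [← e]
  exact hlamL

include hz hGr₁ hGr₂ in
/-- **THE `hsq` BINDER OF ★ `exists_stage_polarization_of_sq_root`: `λ̄ₛ² = Λ(𝒪(Θ₂))` AT EVERY FIELD-VALUED POINT `z` OF THE STAGE, for every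
`Θ₂` with `L^Δ(λₛ)|_{A_z} = z^*Gr^*𝒫ₛ ≅ 𝒪(Θ₂)`** — characteristic-free and square-root-free ([MumfordFogartyKirwan1994] Prop. 6.10 at `z`):
`λₛ·λₛ` classifies the Mumford family of `L^Δ(λₛ)` (previous theorem), ★ `isLambdaOfAt_of_classify_mumfordBundle_of_iso`, `λₛ ^ 2 = λₛ·λₛ`.
HYPOTHESES as above + the unit hypothesis `hD` of the stage dual pair. [cite: MumfordFogartyKirwan1994, Ch. 6 §2 Proposition 6.10 (p. 121) and Definition 6.2 (p. 120)]
[cite: MumfordAV1970, §8 (pp. 74–75)] -/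
theorem isLambdaOfAt_sq_of_iso_LDelta
    (hD : Nonempty ((Scheme.Modules.pullback (DualPair.unitHatSlice (Dₜ.baseChange (stageOver (nonZeroDivisors A) P σ).hom))).obj
      (Dₜ.baseChange (stageOver (nonZeroDivisors A) P σ).hom).P ≅ SheafOfModules.unit _))
    {Ω : Type u} [Field Ω] (zb : Spec (.of Ω) ⟶ (stageOver (nonZeroDivisors A) P σ).left)
    (Θ₂ : CartierDivisor ((𝒜ₜ.baseChange (stageOver (nonZeroDivisors A) P σ).hom).fibre zb).toAbelianVariety.X.left)
    (e : Nonempty ((Scheme.Modules.pullback (pullback.fst (𝒜ₜ.baseChange (stageOver (nonZeroDivisors A) P σ).hom).X.hom zb)).obj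
      ((Scheme.Modules.pullback Gr).obj (Dₜ.baseChange (stageOver (nonZeroDivisors A) P σ).hom).P) ≅
      (𝒜ₜ.baseChange (stageOver (nonZeroDivisors A) P σ).hom).lineBundleOfDivisor zb Θ₂)) :
    (𝒜ₜ.baseChange (stageOver (nonZeroDivisors A) P σ).hom).IsLambdaOfAt zb (Dₜ.baseChange (stageOver (nonZeroDivisors A) P σ).hom)
      (lamₛ ^ 2) Θ₂ := by
  obtain ⟨e⟩ := e
  rw [pow_two]
  exact (𝒜ₜ.baseChange (stageOver (nonZeroDivisors A) P σ).hom).isLambdaOfAt_of_classify_mumfordBundle_of_iso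
    (Dₜ.baseChange (stageOver (nonZeroDivisors A) P σ).hom) zb (hasRank_pullback Gr (Dₜ.baseChange _).hasRank_one) (lamₛ * lamₛ)
    (classify_mumfordBundle_LDelta_mul_self K σ 𝒜ₜ Dₜ pol lamₛ hz Gr hGr₁ hGr₂ hD) e

end Stage

end AbelianSchemeOver

end Literature.AlgebraicGeometry.AbelianSchemes

end
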